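import Summits.HubbardSuperconductivity.HubbardSuperconductivity.Theorems.LogColdTorusAverageToEveryRegimeMap
import HarnessLib

/-!
# Route `LogColdTorus`, crux `AverageToEvery` (item `stmt-HubbardSuperconductivity-10519`, shared with route
`AbelianDuality`): the crux's LIVE REGION — it is equivalent to its restriction to doped data inside the regime map

Helpers (`--supports`) for the crux
`Summit.HubbardSuperconductivity.HubbardSuperconductivity.Theses.LogColdTorus.AverageToEvery` (lead c20),
sequel of `LogColdTorusAverageToEveryRegimeMap.lean` (the regime map `blockWindow_regimeMap` of the crux's
block-format window hypothesis: Yang `c ≤ 2(1-δ)(1+δ)` and carrier `c ≤ 80δ + 640/U₂` for `0 ≤ δ ≤ 1`,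
pairing-cost floor `c/(10⁵ log²(4+32/√c)) ≤ U₁` and weak-coupling ceiling `c ≤ 10⁵ U₁ log²(4+32/√U₁)`
for `δ ≥ -1`).

* `averageToEvery_instance_of_offRegime` — at every datum with `-1 ≤ δ ≤ 1` OUTSIDE the regime map the
  crux's instance holds (its hypothesis is refuted there); named slices `averageToEvery_of_yang_lt`
  (constants above Yang's ceiling — e.g. every `c > 0` at dopings `δ² ≥ 1 - c/2`),
  `averageToEvery_of_carrier_lt` (windows reaching above the carrier ceiling — the Mott corner),
  `averageToEvery_of_lt_floor` (windows reaching below the pairing-cost floor — weak coupling);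
* `averageToEvery_iff_onLiveRegion` — **the crux is EQUIVALENT to its restriction to the live region**
  `0 < |δ| < 1`, `(0 ≤ δ → c ≤ 2(1-δ)(1+δ) ∧ c ≤ 80δ + 640/U₂)`, `c/(10⁵ log²(4+32/√c)) ≤ U₁`,
  `c ≤ 10⁵ U₁ log²(4+32/√U₁)` (the slices `δ = 0`, `|δ| ≥ 1` are the theorems
  `averageToEvery_halfFilling`, `averageToEvery_of_one_le_abs`; off the map the hypothesis fails);
* `averageToEvery_iff_liveDopedTransfer` — the same with the conclusion in transfer form (every
  normalised sector ground state at the produced coupling carries `a L⁴`), sharpening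
  `averageToEvery_iff_dopedTransfer`: the exact open residual of the item.

Sources: C. N. Yang, Rev. Mod. Phys. 34 (1962) 694, §3; F. C. Zhang, C. Gross, T. M. Rice, H. Shiba,
Supercond. Sci. Technol. 1 (1988) 36, §2; J. Bardeen, L. N. Cooper, J. R. Schrieffer, Phys. Rev. 108
(1957) 1175, §II; E. H. Lieb, PRL 62 (1989) 1201; H. Tasaki (2020) §2.1–2.2. Folklore bookkeeping over
landed theorems; no definition and no named fact is introduced; nothing asserts a Theses decl.
-/

noncomputable section

-- `dupNamespace`: the summit and the problem are both named `HubbardSuperconductivity` (layout D-0022)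
set_option linter.dupNamespace false

namespace Summit.HubbardSuperconductivity.HubbardSuperconductivity.Theorems

open Matrix Finset Filter
open Literature.Probability.LatticeModels Literature.MathematicalPhysics.QuantumLattice
open scoped ComplexOrder Matrix Classical

/-! ## §3 The crux off the regime map: vacuous instances -/

/-- **Off the regime map the crux's instance holds** (`-1 ≤ δ ≤ 1`): at any datum violating one of the
four constraints of `blockWindow_regimeMap` the window hypothesis of `AverageToEvery` fails, so its
implication holds. (For `|δ| > 1` and `δ = ±1` the instance is the theorem
`averageToEvery_of_one_le_abs` regardless.) [folklore] -/
theorem averageToEvery_instance_of_offRegime :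
    ∀ (δ U₁ U₂ c : ℝ) (L₀ : ℕ), -1 ≤ δ → δ ≤ 1 → 0 < U₁ → U₁ < U₂ → 0 < c →
      ¬ ((0 ≤ δ → c ≤ 2 * (1 - δ) * (1 + δ) ∧ c ≤ 80 * δ + 640 / U₂) ∧
          c / (100000 * Real.log (4 + 32 / Real.sqrt c) ^ 2) ≤ U₁ ∧
          c ≤ 100000 * U₁ * Real.log (4 + 32 / Real.sqrt U₁) ^ 2) →
      (∀ U ∈ Set.Ioo U₁ U₂, ∀ (L : ℕ) [NeZero L], L₀ ≤ L → Even L →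
        let p : Finset (Orb (FermionTorus 2 L)) → Prop := fun s =>
          s.card = 2 * ⌊(1 - δ) * (L : ℝ) ^ 2 / 2⌋₊ ∧
            2 * (s.filter fun i => (ofLex i).2 = 0).card = 2 * ⌊(1 - δ) * (L : ℝ) ^ 2 / 2⌋₊
        c * (L : ℝ) ^ 4 ≤ (((hubbardTorus 2 L 1 U).toBlock p p).groundStateFunctional
          (((pairField dWaveFormFactor L)ᴴ * pairField dWaveFormFactor L).toBlock p p)).re) →
      ∃ U ∈ Set.Ioo U₁ U₂, ∀ (N : ℕ → ℕ) (ψ : ∀ L, Fock (Orb (FermionTorus 2 L))),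
        (∀ L, Even L → N L = 2 * ⌊(1 - δ) * (L : ℝ) ^ 2 / 2⌋₊ ∧ star (ψ L) ⬝ᵥ ψ L = 1 ∧
          IsGroundStateInSector (hubbardTorus 2 L 1 U) (N L) 0 (ψ L)) →
        HasLongRangeOrder (fun k => halfOpenBox 2 (2 * k))
          (fun k => torusPullback (pairFieldCorr dWaveFormFactor ψ) (2 * k)) :=
  fun _ _ _ _ _ hδ hδ1 hU₁ hU hc hoff hyp => (hoff (blockWindow_regimeMap hδ hδ1 hU₁ hU hc hyp)).elim

/-- **Yang slice: the crux HOLDS for constants above Yang's ceiling** (`0 ≤ δ ≤ 1`, `2(1-δ)(1+δ) < c`;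
in particular for every `c > 0` at all dopings `δ ∈ [√(max 0 (1 - c/2)), 1]`). Yang (1962) §3. [folklore] -/
theorem averageToEvery_of_yang_lt :
    ∀ (δ U₁ U₂ c : ℝ) (L₀ : ℕ), 0 ≤ δ → δ ≤ 1 → 2 * (1 - δ) * (1 + δ) < c → 0 < U₁ → U₁ < U₂ → 0 < c →
      (∀ U ∈ Set.Ioo U₁ U₂, ∀ (L : ℕ) [NeZero L], L₀ ≤ L → Even L →
        let p : Finset (Orb (FermionTorus 2 L)) → Prop := fun s =>
          s.card = 2 * ⌊(1 - δ) * (L : ℝ) ^ 2 / 2⌋₊ ∧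
            2 * (s.filter fun i => (ofLex i).2 = 0).card = 2 * ⌊(1 - δ) * (L : ℝ) ^ 2 / 2⌋₊
        c * (L : ℝ) ^ 4 ≤ (((hubbardTorus 2 L 1 U).toBlock p p).groundStateFunctional
          (((pairField dWaveFormFactor L)ᴴ * pairField dWaveFormFactor L).toBlock p p)).re) →
      ∃ U ∈ Set.Ioo U₁ U₂, ∀ (N : ℕ → ℕ) (ψ : ∀ L, Fock (Orb (FermionTorus 2 L))),
        (∀ L, Even L → N L = 2 * ⌊(1 - δ) * (L : ℝ) ^ 2 / 2⌋₊ ∧ star (ψ L) ⬝ᵥ ψ L = 1 ∧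
          IsGroundStateInSector (hubbardTorus 2 L 1 U) (N L) 0 (ψ L)) →
        HasLongRangeOrder (fun k => halfOpenBox 2 (2 * k))
          (fun k => torusPullback (pairFieldCorr dWaveFormFactor ψ) (2 * k)) :=
  fun _ _ _ _ _ hδ0 hδ1 hlt _ hU hc hyp =>
    absurd (blockWindow_const_le_yang hδ0 hδ1 hU hc hyp) (not_le.mpr hlt)

/-- **Carrier slice: the crux HOLDS on windows reaching above the carrier ceiling** (`0 ≤ δ ≤ 1`,
`80δ + 640/U₂ < c`): near the Mott corner `δ → 0`, `U₂ → ∞` every positive constant is above the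
ceiling. Zhang–Gross–Rice–Shiba (1988) §2. [folklore] -/
theorem averageToEvery_of_carrier_lt :
    ∀ (δ U₁ U₂ c : ℝ) (L₀ : ℕ), 0 ≤ δ → δ ≤ 1 → 80 * δ + 640 / U₂ < c → 0 < U₁ → U₁ < U₂ → 0 < c →
      (∀ U ∈ Set.Ioo U₁ U₂, ∀ (L : ℕ) [NeZero L], L₀ ≤ L → Even L →
        let p : Finset (Orb (FermionTorus 2 L)) → Prop := fun s =>
          s.card = 2 * ⌊(1 - δ) * (L : ℝ) ^ 2 / 2⌋₊ ∧
            2 * (s.filter fun i => (ofLex i).2 = 0).card = 2 * ⌊(1 - δ) * (L : ℝ) ^ 2 / 2⌋₊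
        c * (L : ℝ) ^ 4 ≤ (((hubbardTorus 2 L 1 U).toBlock p p).groundStateFunctional
          (((pairField dWaveFormFactor L)ᴴ * pairField dWaveFormFactor L).toBlock p p)).re) →
      ∃ U ∈ Set.Ioo U₁ U₂, ∀ (N : ℕ → ℕ) (ψ : ∀ L, Fock (Orb (FermionTorus 2 L))),
        (∀ L, Even L → N L = 2 * ⌊(1 - δ) * (L : ℝ) ^ 2 / 2⌋₊ ∧ star (ψ L) ⬝ᵥ ψ L = 1 ∧
          IsGroundStateInSector (hubbardTorus 2 L 1 U) (N L) 0 (ψ L)) →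
        HasLongRangeOrder (fun k => halfOpenBox 2 (2 * k))
          (fun k => torusPullback (pairFieldCorr dWaveFormFactor ψ) (2 * k)) :=
  fun _ _ _ _ _ hδ0 hδ1 hlt hU₁ hU hc hyp =>
    absurd (blockWindow_const_le_carrier hδ0 hδ1 hU₁ hU hc hyp) (not_le.mpr hlt)

/-- **Pairing-cost slice: the crux HOLDS on windows reaching below the pairing-cost floor** (every
`δ ≥ -1`, `U₁ < c/(10⁵ log²(4+32/√c))`). Bardeen–Cooper–Schrieffer (1957) §II. [folklore] -/
theorem averageToEvery_of_lt_floor :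
    ∀ (δ U₁ U₂ c : ℝ) (L₀ : ℕ), -1 ≤ δ → U₁ < c / (100000 * Real.log (4 + 32 / Real.sqrt c) ^ 2) →
      0 < U₁ → U₁ < U₂ → 0 < c →
      (∀ U ∈ Set.Ioo U₁ U₂, ∀ (L : ℕ) [NeZero L], L₀ ≤ L → Even L →
        let p : Finset (Orb (FermionTorus 2 L)) → Prop := fun s =>
          s.card = 2 * ⌊(1 - δ) * (L : ℝ) ^ 2 / 2⌋₊ ∧
            2 * (s.filter fun i => (ofLex i).2 = 0).card = 2 * ⌊(1 - δ) * (L : ℝ) ^ 2 / 2⌋₊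
        c * (L : ℝ) ^ 4 ≤ (((hubbardTorus 2 L 1 U).toBlock p p).groundStateFunctional
          (((pairField dWaveFormFactor L)ᴴ * pairField dWaveFormFactor L).toBlock p p)).re) →
      ∃ U ∈ Set.Ioo U₁ U₂, ∀ (N : ℕ → ℕ) (ψ : ∀ L, Fock (Orb (FermionTorus 2 L))),
        (∀ L, Even L → N L = 2 * ⌊(1 - δ) * (L : ℝ) ^ 2 / 2⌋₊ ∧ star (ψ L) ⬝ᵥ ψ L = 1 ∧
          IsGroundStateInSector (hubbardTorus 2 L 1 U) (N L) 0 (ψ L)) →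
        HasLongRangeOrder (fun k => halfOpenBox 2 (2 * k))
          (fun k => torusPullback (pairFieldCorr dWaveFormFactor ψ) (2 * k)) :=
  fun _ _ _ _ _ hδ hlt hU₁ hU hc hyp =>
    absurd (blockWindow_floor hδ hU₁.le hU hc hyp) (not_le.mpr hlt)

/-! ## §4 The live region: the crux is equivalent to its restriction to it -/

/-- **`AverageToEvery` ⟺ its restriction to the live region.** The crux is equivalent to the same
statement with the leading data restricted to `0 < |δ| < 1` AND to the regime map
`(0 ≤ δ → c ≤ 2(1-δ)(1+δ) ∧ c ≤ 80δ + 640/U₂)`, `c/(10⁵ log²(4+32/√c)) ≤ U₁`,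
`c ≤ 10⁵ U₁ log²(4+32/√U₁)`: the slices `|δ| ≥ 1` (`averageToEvery_of_one_le_abs`) and `δ = 0`
(`averageToEvery_halfFilling`, Lieb's Theorem 2) are theorems, and at doped data off the map the
window hypothesis is refuted (`blockWindow_regimeMap`). So the item's open content lives exactly on:
doped fillings, constants below Yang's and the carrier ceiling, windows above the pairing-cost floor.
Yang (1962) §3; Zhang–Gross–Rice–Shiba (1988) §2; Bardeen–Cooper–Schrieffer (1957) §II; Lieb, PRL 62
(1989) 1201. [folklore] -/
theorem averageToEvery_iff_onLiveRegion :
    Summit.HubbardSuperconductivity.HubbardSuperconductivity.Theses.LogColdTorus.AverageToEvery ↔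
    (∀ (δ U₁ U₂ c : ℝ) (L₀ : ℕ), 0 < |δ| → |δ| < 1 → 0 < U₁ → U₁ < U₂ → 0 < c →
      (0 ≤ δ → c ≤ 2 * (1 - δ) * (1 + δ) ∧ c ≤ 80 * δ + 640 / U₂) →
      c / (100000 * Real.log (4 + 32 / Real.sqrt c) ^ 2) ≤ U₁ →
      c ≤ 100000 * U₁ * Real.log (4 + 32 / Real.sqrt U₁) ^ 2 →
      (∀ U ∈ Set.Ioo U₁ U₂, ∀ (L : ℕ) [NeZero L], L₀ ≤ L → Even L →
        let p : Finset (Orb (FermionTorus 2 L)) → Prop := fun s =>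
          s.card = 2 * ⌊(1 - δ) * (L : ℝ) ^ 2 / 2⌋₊ ∧
            2 * (s.filter fun i => (ofLex i).2 = 0).card = 2 * ⌊(1 - δ) * (L : ℝ) ^ 2 / 2⌋₊
        c * (L : ℝ) ^ 4 ≤ (((hubbardTorus 2 L 1 U).toBlock p p).groundStateFunctional
          (((pairField dWaveFormFactor L)ᴴ * pairField dWaveFormFactor L).toBlock p p)).re) →
      ∃ U ∈ Set.Ioo U₁ U₂, ∀ (N : ℕ → ℕ) (ψ : ∀ L, Fock (Orb (FermionTorus 2 L))),
        (∀ L, Even L → N L = 2 * ⌊(1 - δ) * (L : ℝ) ^ 2 / 2⌋₊ ∧ star (ψ L) ⬝ᵥ ψ L = 1 ∧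
          IsGroundStateInSector (hubbardTorus 2 L 1 U) (N L) 0 (ψ L)) →
        HasLongRangeOrder (fun k => halfOpenBox 2 (2 * k))
          (fun k => torusPullback (pairFieldCorr dWaveFormFactor ψ) (2 * k))) := by
  constructor
  · intro h δ U₁ U₂ c L₀ _ _ hU₁ hU₁₂ hc _ _ _ hyp
    exact h δ U₁ U₂ c L₀ hU₁ hU₁₂ hc hyp
  · intro hlive δ U₁ U₂ c L₀ hU₁ hU₁₂ hc hyp
    by_cases h1 : 1 ≤ |δ|
    · -- `|δ| ≥ 1`: empty or one-dimensional sectors (theorem)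
      exact averageToEvery_of_one_le_abs δ h1 U₁ U₂ c L₀ hU₁ hU₁₂ hc hyp
    · by_cases h0 : δ = 0
      · -- half filling: Lieb's Theorem 2 (theorem)
        subst h0
        exact averageToEvery_halfFilling U₁ U₂ c L₀ hU₁ hU₁₂ hc hyp
      · -- the doped range `0 < |δ| < 1`, so `-1 ≤ δ ≤ 1`
        have hlt1 : |δ| < 1 := not_le.mp h1
        have hδm : -1 ≤ δ := by linarith [neg_abs_le δ]
        have hδ1 : δ ≤ 1 := by linarith [le_abs_self δ]
        by_cases hreg : (0 ≤ δ → c ≤ 2 * (1 - δ) * (1 + δ) ∧ c ≤ 80 * δ + 640 / U₂) ∧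
            c / (100000 * Real.log (4 + 32 / Real.sqrt c) ^ 2) ≤ U₁ ∧
            c ≤ 100000 * U₁ * Real.log (4 + 32 / Real.sqrt U₁) ^ 2
        · exact hlive δ U₁ U₂ c L₀ (abs_pos.mpr h0) hlt1 hU₁ hU₁₂ hc hreg.1 hreg.2.1 hreg.2.2 hyp
        · exact averageToEvery_instance_of_offRegime δ U₁ U₂ c L₀ hδm hδ1 hU₁ hU₁₂ hc hreg hyp

/-- **`AverageToEvery` ⟺ the doped transfer law ON THE LIVE REGION** (sharpening
`averageToEvery_iff_dopedTransfer` by the regime map): the crux is equivalent to — for data with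
`0 < |δ| < 1` inside the regime map, under the window hypothesis — the existence of a coupling `U` of
the window, a constant `a > 0` and a threshold beyond which EVERY normalised `(N_L, S^z = 0)`-sector
ground state `ψ` of `hubbardTorus 2 L 1 U` has `a L⁴ ≤ re ⟨ψ, Δ_d† Δ_d ψ⟩`. This is the exact open
residual of the item. Scalapino, Phys. Rep. 250 (1995) 329, §2 eq. (2.4); Yang (1962) §3. [folklore] -/
theorem averageToEvery_iff_liveDopedTransfer :
    Summit.HubbardSuperconductivity.HubbardSuperconductivity.Theses.LogColdTorus.AverageToEvery ↔
    (∀ (δ U₁ U₂ c : ℝ) (L₀ : ℕ), 0 < |δ| → |δ| < 1 → 0 < U₁ → U₁ < U₂ → 0 < c →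
      (0 ≤ δ → c ≤ 2 * (1 - δ) * (1 + δ) ∧ c ≤ 80 * δ + 640 / U₂) →
      c / (100000 * Real.log (4 + 32 / Real.sqrt c) ^ 2) ≤ U₁ →
      c ≤ 100000 * U₁ * Real.log (4 + 32 / Real.sqrt U₁) ^ 2 →
      (∀ U ∈ Set.Ioo U₁ U₂, ∀ (L : ℕ) [NeZero L], L₀ ≤ L → Even L →
        let p : Finset (Orb (FermionTorus 2 L)) → Prop := fun s =>
          s.card = 2 * ⌊(1 - δ) * (L : ℝ) ^ 2 / 2⌋₊ ∧
            2 * (s.filter fun i => (ofLex i).2 = 0).card = 2 * ⌊(1 - δ) * (L : ℝ) ^ 2 / 2⌋₊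
        c * (L : ℝ) ^ 4 ≤ (((hubbardTorus 2 L 1 U).toBlock p p).groundStateFunctional
          (((pairField dWaveFormFactor L)ᴴ * pairField dWaveFormFactor L).toBlock p p)).re) →
      ∃ U ∈ Set.Ioo U₁ U₂, ∃ a : ℝ, 0 < a ∧ ∃ L₁ : ℕ, ∀ (L : ℕ) [NeZero L], L₁ ≤ L → Even L →
        ∀ ψ : Fock (Orb (FermionTorus 2 L)),
          IsGroundStateInSector (hubbardTorus 2 L 1 U) (2 * ⌊(1 - δ) * (L : ℝ) ^ 2 / 2⌋₊) 0 ψ →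
          star ψ ⬝ᵥ ψ = 1 →
          a * (L : ℝ) ^ 4 ≤
            (star ψ ⬝ᵥ ((pairField dWaveFormFactor L)ᴴ * pairField dWaveFormFactor L) *ᵥ ψ).re) := by
  rw [averageToEvery_iff_onLiveRegion]
  constructor
  · intro h δ U₁ U₂ c L₀ hδ0 hδ1 hU₁ hU₁₂ hc hyc hfl hwc hyp
    obtain ⟨U, hU, hall⟩ := h δ U₁ U₂ c L₀ hδ0 hδ1 hU₁ hU₁₂ hc hyc hfl hwc hyp
    have hδm : -1 ≤ δ := by linarith [neg_abs_le δ]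
    exact ⟨U, hU, groundState_bound_of_forall_hasLRO U δ hδm hall⟩
  · intro hdt δ U₁ U₂ c L₀ hδ0 hδ1 hU₁ hU₁₂ hc hyc hfl hwc hyp
    obtain ⟨U, hU, a, ha, L₁, hL₁⟩ := hdt δ U₁ U₂ c L₀ hδ0 hδ1 hU₁ hU₁₂ hc hyc hfl hwc hyp
    exact ⟨U, hU, fun N ψ hadm =>
      hasLRO_of_forall_groundState_bound U δ a ha L₁
        (fun L _ hL hLe φ hgs hunit => hL₁ L hL hLe φ hgs hunit) N ψ hadm⟩

/-! ## Registered one-line form -/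

/-- **Registered sub-goal `averageToEveryIffOnLiveRegion`** (one-line form of
`averageToEvery_iff_onLiveRegion`, the block hypothesis written with its occupation predicate inlined
exactly as in the crux's registered stub): the crux is equivalent to its restriction to the live region.
[folklore] -/
theorem averageToEveryIffOnLiveRegion : Summit.HubbardSuperconductivity.HubbardSuperconductivity.Theses.LogColdTorus.AverageToEvery ↔ (∀ (δ U₁ U₂ c : ℝ) (L₀ : ℕ), 0 < |δ| → |δ| < 1 → 0 < U₁ → U₁ < U₂ → 0 < c → (0 ≤ δ → c ≤ 2 * (1 - δ) * (1 + δ) ∧ c ≤ 80 * δ + 640 / U₂) → c / (100000 * Real.log (4 + 32 / Real.sqrt c) ^ 2) ≤ U₁ → c ≤ 100000 * U₁ * Real.log (4 + 32 / Real.sqrt U₁) ^ 2 → (∀ U ∈ Set.Ioo U₁ U₂, ∀ (L : ℕ) [NeZero L], L₀ ≤ L → Even L → c * (L : ℝ) ^ 4 ≤ (((hubbardTorus 2 L 1 U).toBlock (fun s : Finset (Orb (FermionTorus 2 L)) => s.card = 2 * ⌊(1 - δ) * (L : ℝ) ^ 2 / 2⌋₊ ∧ 2 * (s.filter fun i =>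 (ofLex i).2 = 0).card = 2 * ⌊(1 - δ) * (L : ℝ) ^ 2 / 2⌋₊) (fun s : Finset (Orb (FermionTorus 2 L)) => s.card = 2 * ⌊(1 - δ) * (L : ℝ) ^ 2 / 2⌋₊ ∧ 2 * (s.filter fun i => (ofLex i).2 = 0).card = 2 * ⌊(1 - δ) * (L : ℝ) ^ 2 / 2⌋₊)).groundStateFunctional ((((pairField dWaveFormFactor L)ᴴ * pairField dWaveFormFactor L)).toBlock (fun s : Finset (Orb (FermionTorus 2 L)) => s.card = 2 * ⌊(1 - δ) * (L : ℝ) ^ 2 / 2⌋₊ ∧ 2 * (s.filter fun i => (ofLex i).2 = 0).card = 2 * ⌊(1 - δ) * (L : ℝ) ^ 2 / 2⌋₊) (fun s : Finset (Orb (FermionTorus 2 L)) => s.card = 2 * ⌊(1 - δ) * (L : ℝ) ^ 2 / 2⌋₊ ∧ 2 * (s.filter fun i => (ofLex i).2 = 0).card = 2 * ⌊(1 - δ) * (L : ℝ) ^ 2 / 2⌋₊))).re) → ∃ U ∈ Set.Ioo U₁ U₂, ∀ (N : ℕ → ℕ) (ψ : ∀ L, Fock (Orb (FermionTorus 2 L))),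 (∀ L, Even L → N L = 2 * ⌊(1 - δ) * (L : ℝ) ^ 2 / 2⌋₊ ∧ star (ψ L) ⬝ᵥ ψ L = 1 ∧ IsGroundStateInSector (hubbardTorus 2 L 1 U) (N L) 0 (ψ L)) → HasLongRangeOrder (fun k => halfOpenBox 2 (2 * k)) (fun k => torusPullback (pairFieldCorr dWaveFormFactor ψ) (2 * k))) :=
  averageToEvery_iff_onLiveRegion.trans
    ⟨fun h δ U₁ U₂ c L₀ h0 h1 hU₁ hU hc hyc hfl hwc hyp =>
        h δ U₁ U₂ c L₀ h0 h1 hU₁ hU hc hyc hfl hwc (fun U hU L _ hL hLe => hyp U hU L hL hLe),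
      fun h δ U₁ U₂ c L₀ h0 h1 hU₁ hU hc hyc hfl hwc hyp =>
        h δ U₁ U₂ c L₀ h0 h1 hU₁ hU hc hyc hfl hwc (fun U hU L _ hL hLe => hyp U hU L hL hLe)⟩

end Summit.HubbardSuperconductivity.HubbardSuperconductivity.Theorems

end
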